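import Literature.AlgebraicGeometry.HodgeTheory.CMFieldMixedPlaces
import HarnessLib

/-!
# An abelian variety with `End⁰(A) ⊇ E = ℚ(φ_E)` a CM field of degree `2|ι| = dim_ℚ End⁰(A)` acting with multiplicity `n₀ ≥ 2`
# has a MIXED place (geometric reading of `CMThetaKWeil.exists_mixed_place`; Deligne LNM 900 I Ex. 3.7, Moonen–Zarhin 1999 (2.3))

Family `hodge`, layer `Literature/AlgebraicGeometry/HodgeTheory` (cell `pub-hodgeav-hg6`, req-37 (A) Q2b, TABLE X ROW 10; eng-5 g7:
the member datum «a mixed place» of the row-10 wrapper `census_row10_quartic_of_mixedPlace` is REDUNDANT). Companion of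
`CMFieldMixedPlaces` (eng-4 g8), which exports only the two-place `K`-Weil form; this file exports the plain existence statement
with the same dictionary. UNCONDITIONAL; theorems only, no definition, no named fact, no `sorry`. HONEST FRAMING of that cell:
HC / HC_AV / HC_CM / H2 NOT proved.

* **`AbelianVariety.exists_eigenMultiplicity_ne_zero_of_cmField`** — for `A` with `finrank_ℚ End⁰(A) = 2|ι|`, `φ ∈ End(A)` with
  colours `μ : ι → ℂ` (injective, none conjugate to another or itself) of pair multiplicity `n₀ ≥ 2` and `dim A = |ι| n₀`:
  SOME place `k` has `eigenMultiplicity A φ (μ k) ≠ 0` and `eigenMultiplicity A φ (conj μ k) ≠ 0` (all places `Θ`-scalar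
  would make `Lie Hg ⊆ E` abelian and the `E`-eigenspaces reducible).

## References
* [Deligne1982HodgeCycles] P. Deligne, LNM 900 (1982), I §3 Prop. 3.4 and Ex. 3.7.
* [MoonenZarhin1999LowDim] B. Moonen, Yu. Zarhin, Math. Ann. 315 (1999), §2 (2.3).
* [MumfordAV1970] D. Mumford, Abelian Varieties (1970), §19 Cor. 2 of Thm. 1 (p. 174).
-/

noncomputable section

open scoped TensorProduct Matrix
open CategoryTheory Module

namespace Literature.AlgebraicGeometry.HodgeTheory

open Literature.AlgebraicTopology.SingularHomology
open Literature.AlgebraicGeometry.Motives (IsSmoothProjective AbelianVariety bettiCohomology HodgeTensorFacts hodgeTensorFacts_holds)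
open Literature.AlgebraicGeometry.Motives.HodgeStructure
open Literature.AlgebraicGeometry.ComplexMultiplication (bettiRep bettiRep_of)

variable {ι : Type} [Fintype ι] [DecidableEq ι]

/-- The two elements of `Fin 2`. [folklore] -/
private theorem fin2_cases₉ (r : Fin 2) : r = 0 ∨ r = 1 := by
  fin_cases r <;> simp

/-- **AN `E`-MULTIPLICATION WITH PAIR MULTIPLICITY `n₀ ≥ 2` AND `dim_ℚ End⁰ = [E:ℚ]` HAS A MIXED PLACE** (see the module
docstring). [cite: Deligne1982HodgeCycles, I §3 Ex. 3.7] [cite: MoonenZarhin1999LowDim, §2 (2.3)]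
[cite: MumfordAV1970, §19 Cor. 2 of Thm. 1 (p. 174)] -/
theorem AbelianVariety.exists_eigenMultiplicity_ne_zero_of_cmField [HodgeTensorFacts.{0, 0}]
    (A : AbelianVariety ℂ) (φ : A ⟶ A) (hE : Module.finrank ℚ A.endAlgebra = 2 * Fintype.card ι)
    (μ : ι → ℂ) (hinj : Function.Injective μ) (hdist : ∀ k k', μ k' ≠ starRingEnd ℂ (μ k)) {n₀ : ℕ} (hn₀ : 2 ≤ n₀)
    (hmult : ∀ k, eigenMultiplicity A φ (μ k) + eigenMultiplicity A φ (starRingEnd ℂ (μ k)) = n₀)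
    (hdim : A.dim = Fintype.card ι * n₀) (k₀ : ι) :
    ∃ k, eigenMultiplicity A φ (μ k) ≠ 0 ∧ eigenMultiplicity A φ (starRingEnd ℂ (μ k)) ≠ 0 := by
  classical
  have hHD : exists_isReal_hodgeModel := exists_isReal_hodgeModel_holds
  have hI : hodgePQ_independent_of_hodgeModel := hodgePQ_independent_of_hodgeModel_holds
  haveI : Module.Finite ℚ (bettiCohomology A.X 1) := finite_bettiCohomology_one A
  have hX : IsSmoothProjective A.dim A.X := AbelianVariety.isSmoothProjective_holds
  have heff := BettiUniverse.hodge_isEffective hHD hX 1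
  obtain ⟨ψ⟩ := BettiUniverse.hodge_isPolarizable hHD (AbelianVariety.isSmoothProjective_holds (A := A)) 1
  set φQ : Module.End ℚ (bettiCohomology A.X 1) := (bettiCohomology.map φ.hom.hom.hom 1).hom with hφQ
  have hφE : φQ ∈ (BettiUniverse.hodge hHD (AbelianVariety.isSmoothProjective_holds (A := A)) 1).endAlg := by
    have h := unop_bettiRep_mem_endAlg hHD hI (AbelianVariety.endAlgebra.of A φ)
    rwa [bettiRep_of, MulOpposite.unop_op] at h
  have hVC : Module.finrank ℂ (ℂ ⊗[ℚ] bettiCohomology A.X 1) = Fintype.card (ι × Fin 2) * n₀ := by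
    rw [Module.finrank_baseChange, finrank_bettiCohomology_one A, hdim, Fintype.card_prod, Fintype.card_fin]; ring
  set ev : ι × Fin 2 → ℂ := fun kt => if kt.2 = 0 then μ kt.1 else starRingEnd ℂ (μ kt.1) with hevdef
  have hev0 : ∀ k, ev (k, 0) = μ k := fun k => by simp [hevdef]
  have hev1 : ∀ k, ev (k, 1) = starRingEnd ℂ (μ k) := fun k => by simp [hevdef]
  have hev : Function.Injective ev := by
    rintro ⟨k, t⟩ ⟨k', t'⟩ h
    rcases fin2_cases₉ t with rfl | rfl <;> rcases fin2_cases₉ t' with rfl | rfl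
    · rw [hev0, hev0] at h; rw [hinj h]
    · rw [hev0, hev1] at h; exact absurd h (hdist k' k)
    · rw [hev1, hev0] at h; exact absurd h.symm (hdist k k')
    · rw [hev1, hev1] at h; rw [hinj ((starRingEnd ℂ).injective h)]
  have hgr := fun cc => CMTheta.finrank_eigenspace_eq_add
    (BettiUniverse.hodge hHD (AbelianVariety.isSmoothProjective_holds (A := A)) 1) Nat.cast_one heff hφE cc
  have h10 : ∀ cc, Module.finrank ℂ ↥(Module.End.eigenspace (φQ.baseChange ℂ) cc ⊓
      (BettiUniverse.hodge hHD (AbelianVariety.isSmoothProjective_holds (A := A)) 1).piece 1 0) = eigenMultiplicity A φ cc :=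
    fun cc => by rw [hφQ, finrank_eigenspace_inf_piece_oneZero_eq_eigenMultiplicity hHD hI φ cc]
  have h01 : ∀ cc, Module.finrank ℂ ↥(Module.End.eigenspace (φQ.baseChange ℂ) cc ⊓
      (BettiUniverse.hodge hHD (AbelianVariety.isSmoothProjective_holds (A := A)) 1).piece 0 1) =
        eigenMultiplicity A φ (starRingEnd ℂ cc) := fun cc => by
    rw [hφQ, finrank_eigenspace_inf_piece_zeroOne_eq_eigenMultiplicity_conj hHD hI φ cc]
  have hfin : ∀ kt, Module.finrank ℂ ↥(Module.End.eigenspace (φQ.baseChange ℂ) (ev kt)) = n₀ := by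
    rintro ⟨k, t⟩
    rw [hgr, h10, h01]
    rcases fin2_cases₉ t with rfl | rfl
    · rw [hev0]; exact hmult k
    · rw [hev1, starRingEnd_self_apply, add_comm]; exact hmult k
  have hWne : ∀ kt, Module.End.eigenspace (φQ.baseChange ℂ) (ev kt) ≠ ⊥ := by
    intro kt hkt
    have h := hfin kt
    rw [hkt, finrank_bot] at h
    omega
  have hcard : Fintype.card (ι × Fin 2) = 2 * Fintype.card ι := by rw [Fintype.card_prod, Fintype.card_fin, mul_comm]
  set e : ι × Fin 2 ≃ Fin (2 * Fintype.card ι) := Fintype.equivFinOfCardEq hcard with hedef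
  have hEφ := exists_eq_sum_smul_pow_bettiMapHom_fin hHD hI φ hE (ev ∘ e.symm) (hev.comp e.symm.injective)
    fun j => hWne (e.symm j)
  have hrank : ∀ k, Module.finrank ℂ ↥(Module.End.eigenspace (φQ.baseChange ℂ) (μ k) ⊓
      (BettiUniverse.hodge hHD (AbelianVariety.isSmoothProjective_holds (A := A)) 1).piece 1 0) +
      Module.finrank ℂ ↥(Module.End.eigenspace (φQ.baseChange ℂ) (μ k) ⊓
      (BettiUniverse.hodge hHD (AbelianVariety.isSmoothProjective_holds (A := A)) 1).piece 0 1) = n₀ := fun k => by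
    rw [h10, h01]; exact hmult k
  have htop : (⨆ kt : ι × Fin 2, Module.End.eigenspace (φQ.baseChange ℂ) (ev kt)) = ⊤ := by
    have hind : iSupIndep fun kt => Module.End.eigenspace (φQ.baseChange ℂ) (ev kt) :=
      (Module.End.eigenspaces_iSupIndep (φQ.baseChange ℂ)).comp hev
    apply Submodule.eq_top_of_finrank_eq
    have h := Motives.finrank_biSup_eq_sum_of_iSupIndep hind Finset.univ
    have hs : (⨆ kt ∈ (Finset.univ : Finset (ι × Fin 2)), Module.End.eigenspace (φQ.baseChange ℂ) (ev kt)) =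
        ⨆ kt, Module.End.eigenspace (φQ.baseChange ℂ) (ev kt) := by simp
    rw [hs] at h
    rw [h, hVC, Finset.sum_congr rfl fun kt _ => hfin kt, Finset.sum_const, Finset.card_univ, smul_eq_mul]
  obtain ⟨k, hk⟩ := CMThetaKWeil.exists_mixed_place (BettiUniverse.hodge hHD (AbelianVariety.isSmoothProjective_holds (A := A)) 1)
    Nat.cast_one heff ψ hφE hEφ μ hinj hdist hn₀ hrank htop k₀
  rw [h10, h01] at hk
  exact ⟨k, hk⟩

end Literature.AlgebraicGeometry.HodgeTheory

end
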